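import Literature.AlgebraicGeometry.AbelianSchemes.AbelianVarietyCechProductComposites
import Literature.AlgebraicGeometry.Modules.CechProductCoverKunnethComponents
import Literature.AlgebraicGeometry.Modules.ModuleCechFiniteOverField
import Literature.AlgebraicGeometry.Modules.CechSectionsCochainDictionary
import Literature.Algebra.Homology.OrderedCechSystemFullResCup
import HarnessLib

/-!
# `Ȟ¹(A, 𝒪) ⊗ Ȟ¹(A, 𝒪) ↠ Ȟ²(A, 𝒪)` for an abelian variety over a field of characteristic `0` (Mumford AV §13 Cor. 2), ordered Čech,
# and the cocycle form: every full Čech `2`-cocycle of `𝒪_A` is a sum of cups of `1`-cocycles plus a coboundary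

Layer `Literature/AlgebraicGeometry/AbelianSchemes`; namespace `Literature.AlgebraicGeometry.AbelianSchemes.AbelianVarietyCech`.  PROOF file.
The bialgebra assembly ★ `Algebra/Bialgebra/DegreeTwoCupSurjectiveOfKunneth.cup_one_one_surjective` (Hopf-algebra argument in degree `2`,
characteristic `0`) instantiated on the ordered module Čech classes of `𝒪` for an abelian variety `A / k` and a finite affine cover `U`:
`HA n = Ȟⁿ(U, 𝒪_A)`, `HS n = Ȟⁿ(W₀, 𝒪_{A×A})` on the product cover, the seven maps and their identities from ★ `AbelianVarietyCechProductMaps`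
∕ `…Composites`, the connectedness `Ȟ⁰ = k·[1]` from ★ `Modules/CechUnitModuleHZeroScalars`, Künneth on the product cover (★ F-K3 road,
T-shape) through ★ `KunnethComponentsBookkeeping`.  HEADS: `cup_one_one_surjective` and the FULL-cochain corollary `exists_sum_cup_add_d`
(★ `Modules/CechRefineClasses.exists_eq_sum_cup_add_sysD` + ★ `Full.exists_d_eq_of_res_eq_sysD`).
[cite: MumfordAV1970, §13 Cor. 2 (p. 129)] [cite: StacksProject, Tag 0BEC]
-/

noncomputable section

open CategoryTheory CategoryTheory.Limits CategoryTheory.MonoidalCategory AlgebraicGeometry TopologicalSpace Opposite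
open HomologicalComplex TensorProduct Finset
open Literature.Algebra.Homology Literature.Algebra.Homology.OrderedCech Literature.AlgebraicGeometry.Modules
open Literature.AlgebraicGeometry.Morphisms

set_option backward.isDefEq.respectTransparency false

namespace Literature.AlgebraicGeometry.AbelianSchemes.AbelianVarietyCech

universe u

section Assembly

variable {k : Type} [Field k] (A : AbelianSchemeOver (Spec (.of k)))
  {ι : Type} [LinearOrder ι] [Fintype ι] (U : ι → A.X.left.affineOpens) (hcov : ⨆ i, (U i).1 = ⊤)
  (W₀ : ι ×ₗ ι → (X2 A).affineOpens)
  (hW₀ : ∀ i j, (W₀ (toLex (i, j))).1 = p₁ A ⁻¹ᵁ (U i).1 ⊓ p₂ A ⁻¹ᵁ (U j).1)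
  (W : (ι ×ₗ ι) ×ₗ ι → (X2 A).affineOpens)
  (hW : ∀ c l, (W (toLex (c, l))).1 = (W₀ c).1 ⊓ m A ⁻¹ᵁ (U l).1)
  (j₀ : ι) (hj₀ : e A ⁻¹ᵁ (U j₀).1 = ⊤)

/-! ### (G3) Künneth on the product cover, T-shape (p04 ∕ p06: ★ F-K3 + ★ B-p06 bridge + «cross = p₁♯ ∪ p₂♯») -/

omit [LinearOrder ι] [Fintype ι] in
/-- `A × A → Spec k` is proper. [cite: MumfordFogartyKirwan1994, Ch. 6 §1 Definition 6.1 (p. 115)] -/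
theorem isProper_X2_hom : IsProper (A.X ⊗ A.X).hom := by
  haveI : IsProper A.X.hom := A.isProper
  change IsProper (pullback.fst A.X.hom A.X.hom ≫ A.X.hom)
  infer_instance

include hcov hW₀ in
/-- **`Ȟⁿ(W₀, 𝒪_{A×A})` is finite-dimensional** (★ `module_finite_homology_cechComplex_scalarRingHomTop`, `A × A` proper).
[cite: GortzWedhorn2023, Thm. 23.17 and Cor. 23.18 (pp. 306–307)] -/
theorem module_finite_CS_homology (n : ℤ) : Module.Finite k ((CS A W₀).homology n) := by
  haveI := isProper_X2_hom A
  haveI : Fintype (ι ×ₗ ι) := inferInstanceAs (Fintype (ι × ι))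
  exact module_finite_homology_cechComplex_scalarRingHomTop (A.X ⊗ A.X) (W₀' A W₀) (hW₀cov A U hcov W₀ hW₀) (hW₀a A W₀)
    (unitModule _) ⟨IsAffineLocalizing.unit, IsAffineFiniteType.unit⟩ n

include hcov in
/-- (G3-inj, T-shape): antidiagonal families with vanishing sum of Künneth components vanish. [cite: MumfordAV1970, §13 Cor. 2 (p. 129)] -/
theorem hinjT (n : ℕ) (T : ∀ p : ℕ × ℕ, (CA A U).homology (p.1 : ℤ) ⊗[k] (CA A U).homology (p.2 : ℤ))
    (hT : (∑ p ∈ antidiagonal n, if h : p.1 + p.2 = n then (TensorProduct.lift ((cupS A W₀ p.1 p.2 n h).compl₁₂ (pOne A U W₀ hW₀ p.1) (pTwo A U W₀ hW₀ p.2))) (T p) else 0) = 0)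
    (p : ℕ × ℕ) (hp : p ∈ antidiagonal n) : T p = 0 := by
  haveI : Fintype (ι ×ₗ ι) := inferInstanceAs (Fintype (ι × ι))
  haveI : Module.Finite (↥(CommRingCat.of k))
      ((cechComplex (W₀' A W₀) (unitModule (pullback A.X.hom A.X.hom)) (ρ₂ A)).homology (n : ℤ)) :=
    module_finite_CS_homology A U hcov W₀ hW₀ (n : ℤ)
  exact hinjT_productCover (IsPullback.of_hasPullback A.X.hom A.X.hom : IsPullback (p₁ A) (p₂ A) A.X.hom A.X.hom)
    ((Scheme.ΓSpecIso (CommRingCat.of k)).commRingCatIsoToRingEquiv.symm : k ≃+* Γ(Spec (CommRingCat.of k), ⊤))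
    (ρX := ρ₁ A) (ρZ := ρ₂ A) (fun _ => rfl)
    (hρ_p₁ A) (hρ_p₂ A) (U' A U) (hUa A U) (W₀' A W₀) hW₀
    (AbelianSchemeOver.productCover_le_preimage_fst A (U' A U) (W₀' A W₀) hW₀)
    (AbelianSchemeOver.productCover_le_preimage_snd A (U' A U) (W₀' A W₀) hW₀) n T hT p hp

include hcov in
/-- (G3-surj, T-shape): every class of `Ȟⁿ(W₀)` is an antidiagonal sum of Künneth components. [cite: MumfordAV1970, §13 Cor. 2 (p. 129)] -/
theorem hsurjT (n : ℕ) (z : (CS A W₀).homology (n : ℤ)) :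
    ∃ T : ∀ p : ℕ × ℕ, (CA A U).homology (p.1 : ℤ) ⊗[k] (CA A U).homology (p.2 : ℤ),
      z = ∑ p ∈ antidiagonal n, if h : p.1 + p.2 = n then (TensorProduct.lift ((cupS A W₀ p.1 p.2 n h).compl₁₂ (pOne A U W₀ hW₀ p.1) (pTwo A U W₀ hW₀ p.2))) (T p) else 0 := by
  haveI : Fintype (ι ×ₗ ι) := inferInstanceAs (Fintype (ι × ι))
  haveI : Module.Finite (↥(CommRingCat.of k))
      ((cechComplex (W₀' A W₀) (unitModule (pullback A.X.hom A.X.hom)) (ρ₂ A)).homology (n : ℤ)) :=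
    module_finite_CS_homology A U hcov W₀ hW₀ (n : ℤ)
  exact hsurjT_productCover (IsPullback.of_hasPullback A.X.hom A.X.hom : IsPullback (p₁ A) (p₂ A) A.X.hom A.X.hom)
    ((Scheme.ΓSpecIso (CommRingCat.of k)).commRingCatIsoToRingEquiv.symm : k ≃+* Γ(Spec (CommRingCat.of k), ⊤))
    (ρX := ρ₁ A) (ρZ := ρ₂ A) (fun _ => rfl)
    (hρ_p₁ A) (hρ_p₂ A) (U' A U) (hUa A U) (W₀' A W₀) hW₀
    (AbelianSchemeOver.productCover_le_preimage_fst A (U' A U) (W₀' A W₀) hW₀)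
    (AbelianSchemeOver.productCover_le_preimage_snd A (U' A U) (W₀' A W₀) hW₀) n z

include hcov in
/-- (G3) `hinj` in the shape of ★ `cup_one_one_surjective`, from the T-shape via ★ B-p21 `eq_zero_of_sum_components_eq_zero`. [cite: MumfordAV1970, §13 Cor. 2 (p. 129)] -/
theorem hinj (κ : Type) (s : Finset κ) (deg : κ → ℕ × ℕ) (hdeg : Set.InjOn deg s) (n : ℕ)
    (t : ∀ i, (CA A U).homology ((deg i).1 : ℤ) ⊗[k] (CA A U).homology ((deg i).2 : ℤ))
    (ht : (∑ i ∈ s, (if h : (deg i).1 + (deg i).2 = n then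
      TensorProduct.lift ((cupS A W₀ (deg i).1 (deg i).2 n h).compl₁₂ (pOne A U W₀ hW₀ (deg i).1)
        (pTwo A U W₀ hW₀ (deg i).2)) (t i) else 0)) = 0)
    (i : κ) (hi : i ∈ s) (hin : (deg i).1 + (deg i).2 = n) : t i = 0 :=
  KunnethComponents.eq_zero_of_sum_components_eq_zero (HA := fun a : ℕ => (CA A U).homology (a : ℤ)) n
    (fun p h => (TensorProduct.lift ((cupS A W₀ p.1 p.2 n h).compl₁₂ (pOne A U W₀ hW₀ p.1) (pTwo A U W₀ hW₀ p.2)))) (fun T hT => hinjT A U hcov W₀ hW₀ n T hT) s deg hdeg t ht hi hin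

include hcov in
/-- (G3) `hsurj` in the shape of ★ `cup_one_one_surjective` (= the T-shape). [cite: MumfordAV1970, §13 Cor. 2 (p. 129)] -/
theorem hsurj (n : ℕ) (z : (CS A W₀).homology (n : ℤ)) :
    ∃ t : ∀ p : ℕ × ℕ, (CA A U).homology (p.1 : ℤ) ⊗[k] (CA A U).homology (p.2 : ℤ),
      z = ∑ p ∈ antidiagonal n, (if h : p.1 + p.2 = n then
        TensorProduct.lift ((cupS A W₀ p.1 p.2 n h).compl₁₂ (pOne A U W₀ hW₀ p.1) (pTwo A U W₀ hW₀ p.2)) (t p)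
        else 0) :=
  hsurjT A U hcov W₀ hW₀ n z

/-! ## §3 HEAD 1 — `Ȟ¹(U, 𝒪_A) ⊗ Ȟ¹(U, 𝒪_A) ↠ Ȟ²(U, 𝒪_A)` -/

include hcov hW₀ hW hj₀ in
/-- **F-J3b, head 1, with the covers as binders.** [cite: MumfordAV1970, §13 Cor. 2 (p. 129)] -/
theorem cup_one_one_surjective_of_covers [CharZero k] :
    Function.Surjective (TensorProduct.lift (cupA A U 1 1 2 rfl)) := by
  classical
  have hρ₁ : Function.Bijective (ρ₁ A) :=
    (A.app_bijective_of_isArtinianRing ⊤).comp (Scheme.ΓSpecIso (.of k)).commRingCatIsoToRingEquiv.symm.bijective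
  obtain ⟨eA, heA⟩ := exists_unitCycle (U' A U) (ρ₁ A)
  obtain ⟨eS, heS⟩ := exists_unitCycle (W₀' A W₀) (ρ₂ A)
  obtain ⟨aug, haug⟩ := exists_augmentation (U' A U) (ρ₁ A) hcov hρ₁ eA heA
  haveI : Fintype (ι ×ₗ ι) := inferInstanceAs (Fintype (ι × ι))
  exact Literature.Algebra.Bialgebra.cup_one_one_surjective (k := k)
    (HA := fun n => (CA A U).homology (n : ℤ)) (HS := fun n => (CS A W₀).homology (n : ℤ))
    (cupA := cupA A U) (cupS := cupS A W₀) (m := mS A U hcov W₀ hW₀ W hW) (p₁ := pOne A U W₀ hW₀)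
    (p₂ := pTwo A U W₀ hW₀) (i₁ := iOne A U W₀ hW₀ j₀ hj₀) (i₂ := iTwo A U W₀ hW₀ j₀ hj₀) (sw := swS A U W₀ hW₀)
    (oneA := ((CA A U).homologyπ _).hom eA) (oneS := ((CS A W₀).homologyπ _).hom eS) (aug := aug)
    (haug := haug)
    (hp₁_one := pOne_one A U W₀ hW₀ eA eS heA heS) (hp₂_one := pTwo_one A U W₀ hW₀ eA eS heA heS)
    (hm_one := mS_one A U hcov W₀ hW₀ W hW eA eS heA heS)
    (honeA_left := fun b y =>
      cupH_unit_left _ (unitFamily _ _) (unitFamily_compatible _ _) (mulPairing_unitFamily_left _ _) eA heA b y)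
    (honeA_right := fun a y =>
      cupH_unit_right _ (unitFamily _ _) (unitFamily_compatible _ _) (mulPairing_unitFamily_right _ _) eA heA a y)
    (honeS_left := fun b y =>
      cupH_unit_left _ (unitFamily _ _) (unitFamily_compatible _ _) (mulPairing_unitFamily_left _ _) eS heS b y)
    (honeS_right := fun a y =>
      cupH_unit_right _ (unitFamily _ _) (unitFamily_compatible _ _) (mulPairing_unitFamily_right _ _) eS heS a y)
    (hm_mul := mS_mul A U hcov W₀ hW₀ W hW) (hp₁_mul := pOne_mul A U W₀ hW₀) (hp₂_mul := pTwo_mul A U hcov W₀ hW₀)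
    (hsw_mul := swS_mul A U hcov W₀ hW₀) (hi₁_mul := iOne_mul A U W₀ hW₀ j₀ hj₀) (hi₂_mul := iTwo_mul A U W₀ hW₀ j₀ hj₀)
    (hi₁m := hi₁m A U hcov W₀ hW₀ W hW j₀ hj₀) (hi₂m := hi₂m A U hcov W₀ hW₀ W hW j₀ hj₀)
    (hi₁p₁ := hi₁p₁ A U W₀ hW₀ j₀ hj₀) (hi₂p₂ := hi₂p₂ A U W₀ hW₀ j₀ hj₀)
    (hi₁p₂ := hi₁p₂ A U W₀ hW₀ j₀ hj₀) (hi₂p₁ := hi₂p₁ A U W₀ hW₀ j₀ hj₀)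
    (hswm := hswm A U hcov W₀ hW₀ W hW) (hswp₁ := hswp₁ A U W₀ hW₀) (hswp₂ := hswp₂ A U W₀ hW₀)
    (hassoc := fun a b c ab bc n hab hbc h y z w =>
      cupH_assoc _ _ _ _ (mulPairing_assoc (W₀' A W₀) (ρ₂ A)) a b c ab bc n hab hbc h y z w)
    (hcomm := hcomm A U hcov W₀ hW₀)
    (hinj := fun κ s deg hdeg n t ht i hi hin => hinj A U hcov W₀ hW₀ κ s deg hdeg n t ht i hi hin)
    (hsurj := hsurj A U hcov W₀ hW₀)
    (hbound := exists_bound_homology_eq_zero)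

include hcov in
/-- **F-J3b, HEAD 1**: for an abelian variety `A` over a field of characteristic `0` and a finite affine open cover `U`, the cup
product `Ȟ¹(U, 𝒪_A) ⊗ Ȟ¹(U, 𝒪_A) → Ȟ²(U, 𝒪_A)` of ordered module Čech classes is SURJECTIVE. [cite: MumfordAV1970, §13 Cor. 2] -/
theorem cup_one_one_surjective [CharZero k] : Function.Surjective (TensorProduct.lift (cupA A U 1 1 2 rfl)) := by
  haveI : IsSeparated A.X.hom := A.isProper.toIsSeparated
  obtain ⟨W₀, hW₀⟩ := exists_productCover A.X A.X U U
  obtain ⟨W, hW⟩ := exists_tripleCover W₀ (m A) U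
  -- the identity point lies in some `U_{j₀}`
  obtain ⟨j₀, hj₀⟩ : ∃ j₀ : ι, e A ⁻¹ᵁ (U j₀).1 = ⊤ := by
    haveI : Subsingleton ↥((𝟙_ (Over (Spec (CommRingCat.of k)))).left) :=
      inferInstanceAs (Subsingleton (PrimeSpectrum k))
    let y₀ : ↥((𝟙_ (Over (Spec (CommRingCat.of k)))).left) := (⊥ : PrimeSpectrum k)
    have hx : (e A).base y₀ ∈ (⊤ : A.X.left.Opens) := trivial
    rw [← hcov] at hx
    obtain ⟨j₀, hj⟩ := Opens.mem_iSup.mp hx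
    refine ⟨j₀, top_le_iff.mp fun y _ => ?_⟩
    have hy : y = y₀ := Subsingleton.elim _ _
    rw [hy]
    exact hj
  exact cup_one_one_surjective_of_covers A U hcov W₀ hW₀ W hW j₀ hj₀

end Assembly

/-! ## §5 HEAD 2 — every full Čech `2`-cocycle of `𝒪_A` is a sum of cups of `1`-cocycles plus a coboundary -/



section Head2

variable {k : Type} [Field k] [CharZero k] (A : AbelianSchemeOver (Spec (.of k)))
  {ι : Type} [LinearOrder ι] [Fintype ι] (U : ι → A.X.left.affineOpens) (hcov : ⨆ i, (U i).1 = ⊤)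

omit [CharZero k] in
include hcov in
/-- **HEAD 2 (module FULL dialect)**: if `Ȟ¹ ⊗ Ȟ¹ → Ȟ²` is onto (HEAD 1), every FULL Čech `2`-cocycle `c` of `𝒪_A` on `U`
(affine with affine finite intersections) is `∑ᵢ aᵢ ∪ bᵢ + d w` with `aᵢ, bᵢ` full `1`-cocycles and `w` a full `1`-cochain. [cite: MumfordAV1970, §13 Cor. 2 (p. 129)] -/
theorem exists_sum_cup_add_d_of_surjective
    (hsurj : Function.Surjective (TensorProduct.lift (cupA A U 1 1 2 rfl)))
    (c : Full.Cochain (sectionsSystem (U' A U) (unitModule A.X.left) (ρ₁ A)) 2) (hc : ((Full.complex (sectionsSystem (U' A U) (unitModule A.X.left) (ρ₁ A))).d 2 3).hom c = 0) :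
    ∃ (σ : Type) (_ : Fintype σ) (a b : σ → Full.Cochain (sectionsSystem (U' A U) (unitModule A.X.left) (ρ₁ A)) 1)
      (_ : ∀ i, ((Full.complex (sectionsSystem (U' A U) (unitModule A.X.left) (ρ₁ A))).d 1 2).hom (a i) = 0) (_ : ∀ i, ((Full.complex (sectionsSystem (U' A U) (unitModule A.X.left) (ρ₁ A))).d 1 2).hom (b i) = 0)
      (w : Full.Cochain (sectionsSystem (U' A U) (unitModule A.X.left) (ρ₁ A)) 1),
      ((Full.complex (sectionsSystem (U' A U) (unitModule A.X.left) (ρ₁ A))).d 1 2).hom w = c - ∑ i, Full.cup (mulPairing (U' A U) (ρ₁ A)) 1 1 2 rfl (a i) (b i) := by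
  classical
  -- the ordered cocycle `g := res c`
  have hg : sysD (sectionsSystem (U' A U) (unitModule A.X.left) (ρ₁ A)) _ (Full.res (sectionsSystem (U' A U) (unitModule A.X.left) (ρ₁ A)) 2 c) = 0 := by
    rw [Full.sysD_res, hc, map_zero]
  obtain ⟨σ, _, za, zb, x, hdec⟩ :=
    exists_eq_sum_cup_add_sysD (mulPairing (U' A U) (ρ₁ A)) (isNaturalPairing_mulPairing _ _) 1 1 1 rfl hsurj
      (Full.res (sectionsSystem (U' A U) (unitModule A.X.left) (ρ₁ A)) 2 c) hg
  -- the full cocycles `aᵢ := ext (ι zaᵢ)`, `bᵢ := ext (ι zbᵢ)`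
  have hda : ∀ i, ((Full.complex (sectionsSystem (U' A U) (unitModule A.X.left) (ρ₁ A))).d 1 2).hom
      (Full.ext (sectionsSystem (U' A U) (unitModule A.X.left) (ρ₁ A)) 1 (((sysComplex (sectionsSystem (U' A U) (unitModule A.X.left) (ρ₁ A))).iCycles ((1 : ℕ) : ℤ)).hom (za i))) = 0 := fun i => by
    change ((Full.complex (sectionsSystem (U' A U) (unitModule A.X.left) (ρ₁ A))).d 1 (1 + 1)).hom (Full.ext (sectionsSystem (U' A U) (unitModule A.X.left) (ρ₁ A)) 1 _) = 0
    rw [Full.d_ext, sysD_iCycles_apply, map_zero]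
  have hdb : ∀ i, ((Full.complex (sectionsSystem (U' A U) (unitModule A.X.left) (ρ₁ A))).d 1 2).hom
      (Full.ext (sectionsSystem (U' A U) (unitModule A.X.left) (ρ₁ A)) 1 (((sysComplex (sectionsSystem (U' A U) (unitModule A.X.left) (ρ₁ A))).iCycles ((1 : ℕ) : ℤ)).hom (zb i))) = 0 := fun i => by
    change ((Full.complex (sectionsSystem (U' A U) (unitModule A.X.left) (ρ₁ A))).d 1 (1 + 1)).hom (Full.ext (sectionsSystem (U' A U) (unitModule A.X.left) (ρ₁ A)) 1 _) = 0
    rw [Full.d_ext, sysD_iCycles_apply, map_zero]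
  refine ⟨σ, inferInstance, fun i => Full.ext (sectionsSystem (U' A U) (unitModule A.X.left) (ρ₁ A)) 1 (((sysComplex (sectionsSystem (U' A U) (unitModule A.X.left) (ρ₁ A))).iCycles ((1 : ℕ) : ℤ)).hom (za i)),
    fun i => Full.ext (sectionsSystem (U' A U) (unitModule A.X.left) (ρ₁ A)) 1 (((sysComplex (sectionsSystem (U' A U) (unitModule A.X.left) (ρ₁ A))).iCycles ((1 : ℕ) : ℤ)).hom (zb i)), hda, hdb, ?_⟩
  -- `C := c - ∑ aᵢ ∪ bᵢ` is a full cocycle whose restriction is the coboundary `d x`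
  have hCcoc : ((Full.complex (sectionsSystem (U' A U) (unitModule A.X.left) (ρ₁ A))).d 2 3).hom (c - ∑ i, Full.cup (mulPairing (U' A U) (ρ₁ A)) 1 1 2 rfl
      (Full.ext (sectionsSystem (U' A U) (unitModule A.X.left) (ρ₁ A)) 1 (((sysComplex (sectionsSystem (U' A U) (unitModule A.X.left) (ρ₁ A))).iCycles ((1 : ℕ) : ℤ)).hom (za i)))
      (Full.ext (sectionsSystem (U' A U) (unitModule A.X.left) (ρ₁ A)) 1 (((sysComplex (sectionsSystem (U' A U) (unitModule A.X.left) (ρ₁ A))).iCycles ((1 : ℕ) : ℤ)).hom (zb i)))) = 0 := by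
    rw [map_sub, hc, map_sum, zero_sub, neg_eq_zero]
    refine Finset.sum_eq_zero fun i _ => ?_
    change ((Full.complex (sectionsSystem (U' A U) (unitModule A.X.left) (ρ₁ A))).d 2 (2 + 1)).hom _ = 0
    rw [Full.d_cup _ (isNaturalPairing_mulPairing _ _) 1 1 2 rfl]
    change Full.cup _ (1 + 1) 1 (2 + 1) _ (((Full.complex (sectionsSystem (U' A U) (unitModule A.X.left) (ρ₁ A))).d 1 2).hom _) _ +
      (-1 : k) ^ 1 • Full.cup _ 1 (1 + 1) (2 + 1) _ _ (((Full.complex (sectionsSystem (U' A U) (unitModule A.X.left) (ρ₁ A))).d 1 2).hom _) = 0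
    rw [hda, hdb, map_zero, LinearMap.zero_apply, map_zero, smul_zero, add_zero]
  have hres : ∀ i, Full.res (sectionsSystem (U' A U) (unitModule A.X.left) (ρ₁ A)) 2 (Full.cup (mulPairing (U' A U) (ρ₁ A)) 1 1 2 rfl
      (Full.ext (sectionsSystem (U' A U) (unitModule A.X.left) (ρ₁ A)) 1 (((sysComplex (sectionsSystem (U' A U) (unitModule A.X.left) (ρ₁ A))).iCycles ((1 : ℕ) : ℤ)).hom (za i)))
      (Full.ext (sectionsSystem (U' A U) (unitModule A.X.left) (ρ₁ A)) 1 (((sysComplex (sectionsSystem (U' A U) (unitModule A.X.left) (ρ₁ A))).iCycles ((1 : ℕ) : ℤ)).hom (zb i)))) =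
      cup (mulPairing (U' A U) (ρ₁ A)) ((1 : ℕ) : ℤ) ((1 : ℕ) : ℤ) (((1 : ℕ) : ℤ) + 1)
        (((sysComplex (sectionsSystem (U' A U) (unitModule A.X.left) (ρ₁ A))).iCycles ((1 : ℕ) : ℤ)).hom (za i))
        (((sysComplex (sectionsSystem (U' A U) (unitModule A.X.left) (ρ₁ A))).iCycles ((1 : ℕ) : ℤ)).hom (zb i)) := fun i => by
    rw [Full.res_cup _ (isNaturalPairing_mulPairing _ _) (p := 1) (q := 1) (n := 2) rfl, Full.res_ext, Full.res_ext]
    rfl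
  have hCres : Full.res (sectionsSystem (U' A U) (unitModule A.X.left) (ρ₁ A)) 2 (c - ∑ i, Full.cup (mulPairing (U' A U) (ρ₁ A)) 1 1 2 rfl
      (Full.ext (sectionsSystem (U' A U) (unitModule A.X.left) (ρ₁ A)) 1 (((sysComplex (sectionsSystem (U' A U) (unitModule A.X.left) (ρ₁ A))).iCycles ((1 : ℕ) : ℤ)).hom (za i)))
      (Full.ext (sectionsSystem (U' A U) (unitModule A.X.left) (ρ₁ A)) 1 (((sysComplex (sectionsSystem (U' A U) (unitModule A.X.left) (ρ₁ A))).iCycles ((1 : ℕ) : ℤ)).hom (zb i)))) =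
      sysD (sectionsSystem (U' A U) (unitModule A.X.left) (ρ₁ A)) ((1 : ℕ) : ℤ) x := by
    rw [map_sub, map_sum, hdec, Finset.sum_congr rfl fun i _ => hres i]
    exact add_sub_cancel_left _ _
  obtain ⟨w, hw⟩ := Full.exists_d_eq_of_res_eq_sysD (U' A U) (unitModule A.X.left) (ρ₁ A) (hUa A U) hcov
    IsAffineLocalizing.unit 1 _ hCcoc x hCres
  exact ⟨w, hw⟩


include hcov in
/-- **F-J3b, HEAD 2 (unconditional)**: every full Čech `2`-cocycle of `𝒪_A` on a finite affine open cover of an abelian variety over a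
field of characteristic `0` is a finite sum of cups of full `1`-cocycles plus a coboundary. [cite: MumfordAV1970, §13 Cor. 2] -/
theorem exists_sum_cup_add_d (c : Full.Cochain (sectionsSystem (U' A U) (unitModule A.X.left) (ρ₁ A)) 2) (hc : ((Full.complex (sectionsSystem (U' A U) (unitModule A.X.left) (ρ₁ A))).d 2 3).hom c = 0) :
    ∃ (σ : Type) (_ : Fintype σ) (a b : σ → Full.Cochain (sectionsSystem (U' A U) (unitModule A.X.left) (ρ₁ A)) 1)
      (_ : ∀ i, ((Full.complex (sectionsSystem (U' A U) (unitModule A.X.left) (ρ₁ A))).d 1 2).hom (a i) = 0) (_ : ∀ i, ((Full.complex (sectionsSystem (U' A U) (unitModule A.X.left) (ρ₁ A))).d 1 2).hom (b i) = 0)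
      (w : Full.Cochain (sectionsSystem (U' A U) (unitModule A.X.left) (ρ₁ A)) 1),
      ((Full.complex (sectionsSystem (U' A U) (unitModule A.X.left) (ρ₁ A))).d 1 2).hom w = c - ∑ i, Full.cup (mulPairing (U' A U) (ρ₁ A)) 1 1 2 rfl (a i) (b i) :=
  exists_sum_cup_add_d_of_surjective A U hcov (cup_one_one_surjective A U hcov) c hc

end Head2

end Literature.AlgebraicGeometry.AbelianSchemes.AbelianVarietyCech

end
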